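import Mathlib.Analysis.Calculus.LineDeriv.IntegrationByParts
import Mathlib.Analysis.SpecialFunctions.Exponential
import Mathlib.Analysis.InnerProductSpace.Trace
import Mathlib.MeasureTheory.Constructions.BorelSpace.ContinuousLinearMap
import Literature.Analysis.FluidPDE.DissipationAnomaly
import Literature.Analysis.FunctionSpaces.ParametricIntegralSmooth
import HarnessLib

/-!
# Alberti's anisotropic kernel lemma (De Rosa–Inversi 2024, Lemma 2.7, trace-free linear case)

Support file for the discharge of the named fact
`Literature.Barriers.AnomalousDissipation.DeRosaInversi2024_thm12` (`CodimensionOneRigidity.lean`):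
the kernel-optimisation step of Ambrosio's argument.

**Statement proved** (`exists_isMollifier_integral_abs_fderiv_apply_le`). Let `A : ℝ^d →L ℝ^d` be
a trace-free linear map. For every `η > 0` there is a mollifier `ρ` (smooth, compactly supported,
even, nonnegative, `∫ ρ = 1`, i.e. `FluidPDE.IsMollifier ρ`) with `∫ |Dρ(z)(Az)| dz ≤ η`. This is the
case `div = 0` of De Rosa–Inversi, Lemma 2.7 (Alberti's lemma, `inf_ρ ∫ |∇ρ(z) · Mz| dz = |tr M|`,
there for odd Lipschitz divergence-free fields `b(z)` in place of `Mz`; Crippa 2009, Lemma 2.13),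
which is all that the proof of Thm. 1.2 uses.

**Proof** (op. cit., proof of Lemma 2.7, case 1). Fix a mollifier `ρ₀` and `T > 0` and average
`ρ₀` along the flow of `z ↦ Az`: `ρ_T(z) := T⁻¹ ∫₀ᵀ ρ₀(e^{-tA} z) dt`. Then `ρ_T` is smooth
(differentiation under the integral sign, the tree's `contDiff_parametric_integral`), even,
nonnegative, compactly supported, and `Dρ_T(z)(Az) = T⁻¹ (ρ₀(z) - ρ₀(e^{-TA} z))`
(`d/dt ρ₀(e^{-tA}z) = -Dρ₀(e^{-tA}z)(e^{-tA}Az)`), whence `∫ |Dρ_T(z)(Az)| dz ≤ 2/T`.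
*Design note.* The source normalises the mass through `det e^{tA} = e^{t tr A} = 1`; we avoid
determinants: integrating the displayed identity and integrating by parts,
`∫ Dρ_T(z)(Az) dz = -(tr A) ∫ ρ_T = 0`, so `∫ ρ₀ ∘ e^{-TA} = ∫ ρ₀ = 1` for every `T ≥ 0`, and then
`∫ ρ_T = 1` by Fubini.

Also proved: the Lipschitz dependence `A ↦ ∫ |Dρ(z)(Az)| dz` for a fixed `C¹_c` kernel
(`dist_integral_abs_fderiv_apply_le`), used to pass from one matrix to a neighbourhood.

## References

* L. De Rosa, M. Inversi, Comm. Math. Phys. 405 (2024), Lemma 2.7 and its proof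
  (arXiv:2307.09189, §2.6). [DeRosaInversi2024]
* G. Crippa, *The flow associated to weakly differentiable vector fields*, Thesis (2009),
  Lemma 2.13; L. Ambrosio, Invent. Math. 158 (2004).
-/

noncomputable section

open MeasureTheory TopologicalSpace Set Function Filter Topology Metric
open scoped ENNReal NNReal ContDiff RealInnerProductSpace

namespace Literature.Barriers.AnomalousDissipation

namespace CodimensionOneRigidity

open Literature.Analysis Literature.Analysis.FunctionSpaces Literature.Analysis.FluidPDE

variable {d : Type*} [Fintype d]

/-! ### The linear flow `e^{tA}` -/

section Flow

variable (A : EuclideanSpace ℝ d →L[ℝ] EuclideanSpace ℝ d)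

/-- `e^{tA} (e^{-tA} z) = z`. [folklore] -/
theorem exp_smul_apply_exp_neg_smul (t : ℝ) (z : EuclideanSpace ℝ d) :
    NormedSpace.exp (t • A) (NormedSpace.exp ((-t) • A) z) = z := by
  have hmem : ∀ x : EuclideanSpace ℝ d →L[ℝ] EuclideanSpace ℝ d,
      x ∈ Metric.eball (0 : EuclideanSpace ℝ d →L[ℝ] EuclideanSpace ℝ d)
        (NormedSpace.expSeries ℝ (EuclideanSpace ℝ d →L[ℝ] EuclideanSpace ℝ d)).radius := by
    intro x
    rw [NormedSpace.expSeries_radius_eq_top]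
    exact Metric.mem_eball.2 (edist_lt_top x 0)
  rw [show (-t) • A = -(t • A) from neg_smul t A]
  have hc : Commute (t • A) (-(t • A)) := (Commute.refl (t • A)).neg_right
  have h : NormedSpace.exp (t • A) * NormedSpace.exp (-(t • A)) = 1 := by
    rw [← NormedSpace.exp_add_of_commute_of_mem_ball hc (hmem _) (hmem _),
      add_neg_cancel, NormedSpace.exp_zero]
  have h' := congrArg (fun L : EuclideanSpace ℝ d →L[ℝ] EuclideanSpace ℝ d => L z) h
  simpa using h'

/-- The flow map `t ↦ e^{-tA}` is continuous. [folklore] -/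
theorem continuous_exp_neg_smul :
    Continuous fun t : ℝ => NormedSpace.exp ((-t) • A) :=
  (differentiable_exp_smul_const ℝ A).continuous.comp continuous_neg

/-- `(t, z) ↦ e^{tA} z` is continuous. [folklore] -/
theorem continuous_exp_smul_apply :
    Continuous fun p : ℝ × EuclideanSpace ℝ d => NormedSpace.exp (p.1 • A) p.2 :=
  ((differentiable_exp_smul_const ℝ A).continuous.comp continuous_fst).clm_apply continuous_snd

/-- The derivative of the orbit `t ↦ e^{-tA} z`: `d/dt e^{-tA} z = -e^{-tA} (A z)`. [folklore] -/
theorem hasDerivAt_exp_neg_smul_apply (z : EuclideanSpace ℝ d) (t : ℝ) :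
    HasDerivAt (fun s : ℝ => NormedSpace.exp ((-s) • A) z)
      (-(NormedSpace.exp ((-t) • A) (A z))) t := by
  have h1 : HasDerivAt (fun u : ℝ => NormedSpace.exp (u • A)) (NormedSpace.exp ((-t) • A) * A) (-t) :=
    hasDerivAt_exp_smul_const A (-t)
  have h2 : HasDerivAt (fun s : ℝ => NormedSpace.exp ((-s) • A))
      (-(NormedSpace.exp ((-t) • A) * A)) t := by
    have := h1.scomp t (hasDerivAt_neg t)
    simpa [Function.comp_def] using this
  have h3 := h2.clm_apply (hasDerivAt_const t z)
  simpa using h3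

/-- Off the compact set `e^{[0,T]A}(tsupport ρ₀)` the flowed kernels `ρ₀ ∘ e^{-tA}`, `t ∈ [0,T]`,
vanish. [folklore] -/
theorem apply_exp_neg_smul_eq_zero {ρ₀ : EuclideanSpace ℝ d → ℝ} {T t : ℝ} (ht : t ∈ Icc 0 T)
    {z : EuclideanSpace ℝ d}
    (hz : z ∉ (fun p : ℝ × EuclideanSpace ℝ d => NormedSpace.exp (p.1 • A) p.2) ''
      (Icc 0 T ×ˢ tsupport ρ₀)) :
    ρ₀ (NormedSpace.exp ((-t) • A) z) = 0 := by
  by_contra h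
  exact hz ⟨(t, NormedSpace.exp ((-t) • A) z), ⟨ht, subset_tsupport _ (mem_support.2 h)⟩,
    exp_smul_apply_exp_neg_smul A t z⟩

/-- The set `e^{[0,T]A}(tsupport ρ₀)` is compact for compactly supported `ρ₀`. [folklore] -/
theorem isCompact_image_flow {ρ₀ : EuclideanSpace ℝ d → ℝ} (hρ₀ : HasCompactSupport ρ₀) (T : ℝ) :
    IsCompact ((fun p : ℝ × EuclideanSpace ℝ d => NormedSpace.exp (p.1 • A) p.2) ''
      (Icc 0 T ×ˢ tsupport ρ₀)) :=
  (isCompact_Icc.prod hρ₀).image (continuous_exp_smul_apply A)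

end Flow

/-! ### The flow-averaged kernel `z ↦ ∫_{[0,T]} ρ₀(e^{-tA} z) dt` -/

section FlowAvg

variable (A : EuclideanSpace ℝ d →L[ℝ] EuclideanSpace ℝ d) {ρ₀ : EuclideanSpace ℝ d → ℝ}

/-- Joint smoothness of `(L, z) ↦ ρ₀ (L z)` for smooth `ρ₀`. [folklore] -/
theorem contDiff_comp_apply (hρ₀ : ContDiff ℝ ∞ ρ₀) :
    ContDiff ℝ ∞ fun q : (EuclideanSpace ℝ d →L[ℝ] EuclideanSpace ℝ d) × EuclideanSpace ℝ d =>
      ρ₀ (q.1 q.2) :=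
  hρ₀.comp isBoundedBilinearMap_apply.contDiff

/-- **Smoothness of the flow average** (differentiation under the integral sign; De Rosa–Inversi
2024, proof of Lemma 2.7: "`ρ_T` is … Lipschitz", here smooth since `ρ₀` is). [folklore] -/
theorem contDiff_flowAvg (hρ₀ : ContDiff ℝ ∞ ρ₀) (T : ℝ) :
    ContDiff ℝ ∞ fun z : EuclideanSpace ℝ d =>
      ∫ t in Icc 0 T, ρ₀ (NormedSpace.exp ((-t) • A) z) := by
  have hι := continuous_exp_neg_smul A
  exact contDiff_parametric_integral (μ := volume.restrict (Icc (0 : ℝ) T)) hι.measurable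
    (isCompact_Icc.image hι)
    ((ae_restrict_mem measurableSet_Icc).mono fun t ht => mem_image_of_mem _ ht)
    (contDiff_comp_apply hρ₀)

/-- The flow average vanishes off the compact set `e^{[0,T]A}(tsupport ρ₀)`. [folklore] -/
theorem flowAvg_eq_zero {T : ℝ} {z : EuclideanSpace ℝ d}
    (hz : z ∉ (fun p : ℝ × EuclideanSpace ℝ d => NormedSpace.exp (p.1 • A) p.2) ''
      (Icc 0 T ×ˢ tsupport ρ₀)) :
    ∫ t in Icc 0 T, ρ₀ (NormedSpace.exp ((-t) • A) z) = 0 := by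
  refine setIntegral_eq_zero_of_forall_eq_zero fun t ht => ?_
  exact apply_exp_neg_smul_eq_zero A ht hz

/-- The flow average is compactly supported. [folklore] -/
theorem hasCompactSupport_flowAvg (hρ₀c : HasCompactSupport ρ₀) (T : ℝ) :
    HasCompactSupport fun z : EuclideanSpace ℝ d =>
      ∫ t in Icc 0 T, ρ₀ (NormedSpace.exp ((-t) • A) z) :=
  HasCompactSupport.intro (isCompact_image_flow A hρ₀c T) fun _ hz => flowAvg_eq_zero A hz

/-- **The derivative of the flow average along the field**:
`D(∫₀ᵀ ρ₀(e^{-tA}·) dt)(z)(Az) = ρ₀(z) - ρ₀(e^{-TA} z)` (De Rosa–Inversi 2024, proof of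
Lemma 2.7, display (2.13): `∇ρ_T(z) · b(z) = T⁻¹[θ(z) - θ(X_T⁻¹(z))]`). [cite: DeRosaInversi2024, Lemma 2.7] -/
theorem fderiv_flowAvg_apply (hρ₀ : ContDiff ℝ ∞ ρ₀) {T : ℝ} (hT : 0 ≤ T) (z : EuclideanSpace ℝ d) :
    fderiv ℝ (fun z : EuclideanSpace ℝ d =>
        ∫ t in Icc 0 T, ρ₀ (NormedSpace.exp ((-t) • A) z)) z (A z) =
      ρ₀ z - ρ₀ (NormedSpace.exp ((-T) • A) z) := by
  have hι := continuous_exp_neg_smul A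
  have h1 : (∞ : WithTop ℕ∞) ≠ 0 := by simp
  rw [fderiv_parametric_integral_apply (μ := volume.restrict (Icc (0 : ℝ) T)) hι.measurable
    (isCompact_Icc.image hι)
    ((ae_restrict_mem measurableSet_Icc).mono fun t ht => mem_image_of_mem _ ht)
    (contDiff_comp_apply hρ₀) h1 z (A z)]
  -- the derivative of `(L, z) ↦ ρ₀ (L z)` in the direction `(0, A z)`
  have hD : ∀ t : ℝ,
      fderiv ℝ (fun q : (EuclideanSpace ℝ d →L[ℝ] EuclideanSpace ℝ d) × EuclideanSpace ℝ d =>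
          ρ₀ (q.1 q.2)) (NormedSpace.exp ((-t) • A), z)
        ((0 : EuclideanSpace ℝ d →L[ℝ] EuclideanSpace ℝ d), A z) =
      fderiv ℝ ρ₀ (NormedSpace.exp ((-t) • A) z) (NormedSpace.exp ((-t) • A) (A z)) := by
    intro t
    have hB := (isBoundedBilinearMap_apply (𝕜 := ℝ) (E := EuclideanSpace ℝ d)
      (F := EuclideanSpace ℝ d)).hasFDerivAt (NormedSpace.exp ((-t) • A), z)
    have hρ : HasFDerivAt ρ₀ (fderiv ℝ ρ₀ (NormedSpace.exp ((-t) • A) z))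
        ((fun q : (EuclideanSpace ℝ d →L[ℝ] EuclideanSpace ℝ d) × EuclideanSpace ℝ d => q.1 q.2)
          (NormedSpace.exp ((-t) • A), z)) :=
      ((hρ₀.differentiable h1) _).hasFDerivAt
    have hc := (hρ.comp (NormedSpace.exp ((-t) • A), z) hB).fderiv
    simp only [Function.comp_def] at hc
    rw [hc, ContinuousLinearMap.comp_apply, IsBoundedBilinearMap.deriv_apply]
    simp
  simp_rw [hD]
  -- fundamental theorem of calculus along the orbit
  have hderiv : ∀ t : ℝ, HasDerivAt (fun s : ℝ => ρ₀ (NormedSpace.exp ((-s) • A) z))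
      (-(fderiv ℝ ρ₀ (NormedSpace.exp ((-t) • A) z) (NormedSpace.exp ((-t) • A) (A z)))) t := by
    intro t
    have hρ : HasFDerivAt ρ₀ (fderiv ℝ ρ₀ (NormedSpace.exp ((-t) • A) z))
        (NormedSpace.exp ((-t) • A) z) :=
      ((hρ₀.differentiable h1) _).hasFDerivAt
    have := hρ.comp_hasDerivAt t (hasDerivAt_exp_neg_smul_apply A z t)
    simpa [Function.comp_def] using this
  have hcont : Continuous fun t : ℝ =>
      fderiv ℝ ρ₀ (NormedSpace.exp ((-t) • A) z) (NormedSpace.exp ((-t) • A) (A z)) :=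
    ((hρ₀.continuous_fderiv h1).comp (hι.clm_apply continuous_const)).clm_apply
      (hι.clm_apply continuous_const)
  rw [integral_Icc_eq_integral_Ioc, ← intervalIntegral.integral_of_le hT]
  have hFTC := intervalIntegral.integral_eq_sub_of_hasDerivAt (fun t _ => hderiv t)
    (hcont.neg.intervalIntegrable 0 T)
  rw [intervalIntegral.integral_neg] at hFTC
  have hFTC' : ∫ t in (0 : ℝ)..T,
      fderiv ℝ ρ₀ (NormedSpace.exp ((-t) • A) z) (NormedSpace.exp ((-t) • A) (A z)) =
      -(ρ₀ (NormedSpace.exp ((-T) • A) z) - ρ₀ (NormedSpace.exp ((-(0 : ℝ)) • A) z)) := by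
    linarith
  rw [hFTC', neg_zero, show (0 : ℝ) • A = 0 from zero_smul ℝ A, NormedSpace.exp_zero]
  show -(ρ₀ (NormedSpace.exp ((-T) • A) z) - ρ₀ z) = _
  ring

/-- **Integration by parts against a linear field**: for `f ∈ C¹_c(ℝ^d)` and a linear map `A`,
`∫ Df(z)(Az) dz = -(tr A) ∫ f` (expand `Az` in the standard basis and integrate by parts in each
coordinate direction; Mathlib's `integral_bilinear_fderiv_right_eq_neg_left_of_integrable`). [folklore] -/
theorem integral_fderiv_apply_linear [DecidableEq d] {f : EuclideanSpace ℝ d → ℝ}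
    (hf : ContDiff ℝ 1 f) (hfc : HasCompactSupport f) :
    ∫ z, fderiv ℝ f z (A z) =
      -(LinearMap.trace ℝ (EuclideanSpace ℝ d) (A : EuclideanSpace ℝ d →ₗ[ℝ] EuclideanSpace ℝ d)) *
        ∫ z, f z := by
  set b := EuclideanSpace.basisFun d ℝ with hb
  -- expand `A z` in the standard basis
  have hexp : ∀ z, fderiv ℝ f z (A z) = ∑ i, (A z) i * fderiv ℝ f z (b i) := by
    intro z
    conv_lhs => rw [← b.sum_repr (A z)]
    rw [map_sum]
    refine Finset.sum_congr rfl fun i _ => ?_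
    rw [map_smul, smul_eq_mul]
    rfl
  simp_rw [hexp]
  have hfi : Integrable f volume := hf.continuous.integrable_of_hasCompactSupport hfc
  have hDf : Continuous (fderiv ℝ f) := hf.continuous_fderiv one_ne_zero
  -- integrability of each term
  have hint : ∀ i, Integrable (fun z => (A z) i * fderiv ℝ f z (b i)) volume := by
    intro i
    refine Continuous.integrable_of_hasCompactSupport ?_ ?_
    · exact ((EuclideanSpace.proj i).continuous.comp A.continuous).mul
        (hDf.clm_apply continuous_const)
    · exact (hfc.fderiv_apply (𝕜 := ℝ) (b i)).mul_left
  rw [integral_finsetSum _ fun i _ => hint i]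
  -- integrate by parts in the direction `b i`
  have hIBP : ∀ i, ∫ z, (A z) i * fderiv ℝ f z (b i) = -((A (b i)) i * ∫ z, f z) := by
    intro i
    set ℓ : EuclideanSpace ℝ d →L[ℝ] ℝ := (EuclideanSpace.proj i).comp A with hℓ
    have hℓ' : ∀ z, ℓ z = (A z) i := fun z => rfl
    have key := integral_bilinear_fderiv_right_eq_neg_left_of_integrable (μ := volume)
      (f := (ℓ : EuclideanSpace ℝ d → ℝ)) (g := f) (v := b i) (B := ContinuousLinearMap.mul ℝ ℝ)
      ?_ ?_ ?_ ?_ ?_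
    · simp only [ContinuousLinearMap.mul_apply', ContinuousLinearMap.fderiv] at key
      simp only [hℓ'] at key
      rw [key, integral_const_mul]
    · simp only [ContinuousLinearMap.mul_apply', ContinuousLinearMap.fderiv]
      exact hfi.const_mul _
    · simp only [ContinuousLinearMap.mul_apply']
      exact (ℓ.continuous.mul (hDf.clm_apply continuous_const)).integrable_of_hasCompactSupport
        (hfc.fderiv_apply (𝕜 := ℝ) (b i)).mul_left
    · simp only [ContinuousLinearMap.mul_apply']
      exact (ℓ.continuous.mul hf.continuous).integrable_of_hasCompactSupport hfc.mul_left
    · exact fun z _ => ℓ.differentiableAt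
    · exact fun z _ => (hf.differentiable one_ne_zero) z
  simp_rw [hIBP]
  rw [Finset.sum_neg_distrib, ← Finset.sum_mul, neg_mul]
  congr 2
  rw [LinearMap.trace_eq_sum_inner _ b]
  refine Finset.sum_congr rfl fun i _ => ?_
  rw [hb, EuclideanSpace.basisFun_apply, ContinuousLinearMap.coe_coe, EuclideanSpace.inner_single_left]
  simp

/-- **Mass preservation without determinants**: for a trace-free `A`, a mollifier `ρ₀` and
`T ≥ 0`, `∫ ρ₀(e^{-TA} z) dz = 1` (integrate `fderiv_flowAvg_apply` and use
`integral_fderiv_apply_linear`; in the source this is `det X_t = 1` for the incompressible flow).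
[cite: DeRosaInversi2024, Lemma 2.7] -/
theorem integral_comp_exp_neg_smul [DecidableEq d] (hρ₀ : IsMollifier ρ₀)
    (hA : LinearMap.trace ℝ (EuclideanSpace ℝ d)
      (A : EuclideanSpace ℝ d →ₗ[ℝ] EuclideanSpace ℝ d) = 0) {T : ℝ} (hT : 0 ≤ T) :
    ∫ z, ρ₀ (NormedSpace.exp ((-T) • A) z) = 1 := by
  have hsm := contDiff_flowAvg A hρ₀.1 T
  have hcs := hasCompactSupport_flowAvg A hρ₀.2.1 T
  have h0 := integral_fderiv_apply_linear A (hsm.of_le (by simp)) hcs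
  rw [hA, neg_zero, zero_mul] at h0
  simp_rw [fderiv_flowAvg_apply A hρ₀.1 hT] at h0
  have hi₀ : Integrable ρ₀ volume := hρ₀.1.continuous.integrable_of_hasCompactSupport hρ₀.2.1
  have hiT : Integrable (fun z => ρ₀ (NormedSpace.exp ((-T) • A) z)) volume := by
    refine Continuous.integrable_of_hasCompactSupport
      (hρ₀.1.continuous.comp ((NormedSpace.exp ((-T) • A)).continuous)) ?_
    refine HasCompactSupport.intro (isCompact_image_flow A hρ₀.2.1 T) fun z hz => ?_
    exact apply_exp_neg_smul_eq_zero A ⟨hT, le_rfl⟩ hz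
  rw [integral_sub hi₀ hiT, hρ₀.2.2.2.2, sub_eq_zero] at h0
  exact h0.symm

/-- The mass of the flow average: `∫ (∫_{[0,T]} ρ₀(e^{-tA} z) dt) dz = T` (Fubini and
`integral_comp_exp_neg_smul`). [cite: DeRosaInversi2024, Lemma 2.7] -/
theorem integral_flowAvg [DecidableEq d] (hρ₀ : IsMollifier ρ₀)
    (hA : LinearMap.trace ℝ (EuclideanSpace ℝ d)
      (A : EuclideanSpace ℝ d →ₗ[ℝ] EuclideanSpace ℝ d) = 0) {T : ℝ} (hT : 0 ≤ T) :
    ∫ z, ∫ t in Icc 0 T, ρ₀ (NormedSpace.exp ((-t) • A) z) = T := by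
  set S := (fun p : ℝ × EuclideanSpace ℝ d => NormedSpace.exp (p.1 • A) p.2) ''
      (Icc 0 T ×ˢ tsupport ρ₀) with hS
  have hSc : IsCompact S := isCompact_image_flow A hρ₀.2.1 T
  obtain ⟨C, hC⟩ : ∃ C, ∀ w, ‖ρ₀ w‖ ≤ C := hρ₀.1.continuous.bounded_above_of_compact_support hρ₀.2.1
  -- integrability on the product `ℝ^d × [0,T]`
  have hF : Integrable (uncurry fun (z : EuclideanSpace ℝ d) (t : ℝ) =>
      ρ₀ (NormedSpace.exp ((-t) • A) z))
      ((volume : Measure (EuclideanSpace ℝ d)).prod (volume.restrict (Icc (0 : ℝ) T))) := by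
    have hcont : Continuous (uncurry fun (z : EuclideanSpace ℝ d) (t : ℝ) =>
        ρ₀ (NormedSpace.exp ((-t) • A) z)) :=
      hρ₀.1.continuous.comp (((continuous_exp_neg_smul A).comp continuous_snd).clm_apply
        continuous_fst)
    refine Integrable.mono' (g := (S ×ˢ (univ : Set ℝ)).indicator fun _ => C) ?_
      hcont.aestronglyMeasurable ?_
    · refine IntegrableOn.integrable_indicator ?_ (hSc.measurableSet.prod MeasurableSet.univ)
      refine integrableOn_const ?_
      rw [Measure.prod_prod]
      exact ENNReal.mul_ne_top hSc.measure_lt_top.ne (measure_ne_top _ _)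
    · have hae : ∀ᵐ p : EuclideanSpace ℝ d × ℝ ∂((volume : Measure (EuclideanSpace ℝ d)).prod
          (volume.restrict (Icc (0 : ℝ) T))), p.2 ∈ Icc (0 : ℝ) T := by
        have : ((volume : Measure (EuclideanSpace ℝ d)).prod (volume.restrict (Icc (0 : ℝ) T))) =
            ((volume : Measure (EuclideanSpace ℝ d)).prod volume).restrict (univ ×ˢ Icc (0 : ℝ) T) := by
          rw [← Measure.prod_restrict, Measure.restrict_univ]
        rw [this]
        filter_upwards [ae_restrict_mem (MeasurableSet.univ.prod measurableSet_Icc)] with p hp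
        exact hp.2
      filter_upwards [hae] with p hp
      by_cases hz : p.1 ∈ S
      · rw [indicator_of_mem (show p ∈ S ×ˢ (univ : Set ℝ) from ⟨hz, mem_univ _⟩)]
        exact hC _
      · rw [indicator_of_notMem (show p ∉ S ×ˢ (univ : Set ℝ) from fun h => hz h.1)]
        simp only [uncurry]
        rw [apply_exp_neg_smul_eq_zero A hp hz, norm_zero]
  rw [integral_integral_swap hF]
  have h1 : ∀ t ∈ Icc (0 : ℝ) T, ∫ z, ρ₀ (NormedSpace.exp ((-t) • A) z) = 1 := fun t ht =>
    integral_comp_exp_neg_smul A hρ₀ hA ht.1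
  rw [setIntegral_congr_fun measurableSet_Icc h1, setIntegral_const, Real.volume_real_Icc_of_le hT]
  simp

end FlowAvg

/-! ### Alberti's lemma -/

/-- **Alberti's lemma, trace-free linear case** (De Rosa–Inversi 2024, Lemma 2.7 with `b(z) = Az`,
`div b = tr A = 0`; Crippa 2009, Lemma 2.13): for a trace-free `A` and every `η > 0` there is a
mollifier `ρ` (smooth, compactly supported, even, nonnegative, unit mass) with
`∫ |Dρ(z)(Az)| dz ≤ η`. The kernel is the flow average `ρ_T = T⁻¹ ∫₀ᵀ ρ₀(e^{-tA}·) dt` with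
`T = 2/η`, for which `Dρ_T(z)(Az) = T⁻¹(ρ₀(z) - ρ₀(e^{-TA}z))` and hence
`∫ |Dρ_T(z)(Az)| dz ≤ 2/T`. [cite: DeRosaInversi2024, Lemma 2.7] -/
theorem exists_isMollifier_integral_abs_fderiv_apply_le [DecidableEq d]
    (A : EuclideanSpace ℝ d →L[ℝ] EuclideanSpace ℝ d)
    (hA : LinearMap.trace ℝ (EuclideanSpace ℝ d)
      (A : EuclideanSpace ℝ d →ₗ[ℝ] EuclideanSpace ℝ d) = 0) {η : ℝ} (hη : 0 < η) :
    ∃ ρ : EuclideanSpace ℝ d → ℝ, IsMollifier ρ ∧ (∫ z, |fderiv ℝ ρ z (A z)|) ≤ η := by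
  obtain ⟨ρ₀, hρ₀⟩ := exists_isMollifier (d := d)
  set T : ℝ := 2 / η with hTdef
  have hT : 0 < T := by positivity
  set F : EuclideanSpace ℝ d → ℝ := fun z => ∫ t in Icc 0 T, ρ₀ (NormedSpace.exp ((-t) • A) z)
    with hFdef
  have hFsm : ContDiff ℝ ∞ F := contDiff_flowAvg A hρ₀.1 T
  have hFcs : HasCompactSupport F := hasCompactSupport_flowAvg A hρ₀.2.1 T
  have hFd : Differentiable ℝ F := hFsm.differentiable (by simp)
  have hi₀ : Integrable ρ₀ volume := hρ₀.1.continuous.integrable_of_hasCompactSupport hρ₀.2.1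
  have hiT : Integrable (fun z => ρ₀ (NormedSpace.exp ((-T) • A) z)) volume := by
    refine Continuous.integrable_of_hasCompactSupport
      (hρ₀.1.continuous.comp ((NormedSpace.exp ((-T) • A)).continuous)) ?_
    refine HasCompactSupport.intro (isCompact_image_flow A hρ₀.2.1 T) fun z hz => ?_
    exact apply_exp_neg_smul_eq_zero A ⟨hT.le, le_rfl⟩ hz
  refine ⟨fun z => T⁻¹ * F z, ⟨?_, ?_, ?_, ?_, ?_⟩, ?_⟩
  · exact contDiff_const.mul hFsm
  · show HasCompactSupport ((fun _ : EuclideanSpace ℝ d => T⁻¹) * F)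
    exact hFcs.mul_left
  · intro ξ
    show T⁻¹ * F (-ξ) = T⁻¹ * F ξ
    congr 1
    simp only [hFdef, map_neg]
    exact setIntegral_congr_fun measurableSet_Icc fun t _ => hρ₀.2.2.1 _
  · intro ξ
    exact mul_nonneg (inv_nonneg.2 hT.le) (setIntegral_nonneg measurableSet_Icc fun t _ =>
      hρ₀.2.2.2.1 _)
  · show ∫ ξ, T⁻¹ * F ξ = 1
    rw [integral_const_mul, hFdef, integral_flowAvg A hρ₀ hA hT.le, inv_mul_cancel₀ hT.ne']
  · -- `D(T⁻¹ F)(z)(Az) = T⁻¹ (ρ₀ z - ρ₀ (e^{-TA} z))`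
    have hD : ∀ z, fderiv ℝ (fun z => T⁻¹ * F z) z (A z) =
        T⁻¹ * (ρ₀ z - ρ₀ (NormedSpace.exp ((-T) • A) z)) := by
      intro z
      rw [fderiv_const_mul (hFd z)]
      show T⁻¹ • fderiv ℝ F z (A z) = _
      rw [smul_eq_mul, hFdef, fderiv_flowAvg_apply A hρ₀.1 hT.le z]
    simp_rw [hD, abs_mul, abs_of_pos (inv_pos.2 hT)]
    rw [integral_const_mul]
    have hle : ∫ z, |ρ₀ z - ρ₀ (NormedSpace.exp ((-T) • A) z)| ≤ 2 := by
      calc ∫ z, |ρ₀ z - ρ₀ (NormedSpace.exp ((-T) • A) z)|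
          ≤ ∫ z, (ρ₀ z + ρ₀ (NormedSpace.exp ((-T) • A) z)) := by
            refine integral_mono (hi₀.sub hiT).abs (hi₀.add hiT) fun z => ?_
            have h1 := hρ₀.2.2.2.1 z
            have h2 := hρ₀.2.2.2.1 (NormedSpace.exp ((-T) • A) z)
            exact abs_sub_le_iff.2 ⟨by linarith, by linarith⟩
        _ = 2 := by
            rw [integral_add hi₀ hiT, hρ₀.2.2.2.2, integral_comp_exp_neg_smul A hρ₀ hA hT.le]
            norm_num
    calc T⁻¹ * ∫ z, |ρ₀ z - ρ₀ (NormedSpace.exp ((-T) • A) z)| ≤ T⁻¹ * 2 := by gcongr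
      _ = η := by rw [hTdef]; field_simp

/-! ### Lipschitz dependence of `A ↦ ∫ |Dρ(z)(Az)| dz` on the matrix -/

/-- The anisotropic energy `z ↦ |Dρ(z)(Az)|` of a `C¹_c` kernel is integrable. [folklore] -/
theorem integrable_abs_fderiv_apply {ρ : EuclideanSpace ℝ d → ℝ} (hρ : ContDiff ℝ 1 ρ)
    (hρc : HasCompactSupport ρ) (A : EuclideanSpace ℝ d →L[ℝ] EuclideanSpace ℝ d) :
    Integrable (fun z => |fderiv ℝ ρ z (A z)|) volume := by
  refine (Continuous.integrable_of_hasCompactSupport ?_ ?_).abs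
  · exact (hρ.continuous_fderiv one_ne_zero).clm_apply A.continuous
  · refine (hρc.fderiv (𝕜 := ℝ)).mono fun z hz => ?_
    rw [Function.mem_support] at hz ⊢
    intro h0
    exact hz (by simp [h0])

/-- The moment `z ↦ ‖Dρ(z)‖ ‖z‖` of a `C¹_c` kernel is integrable. [folklore] -/
theorem integrable_norm_fderiv_mul_norm {ρ : EuclideanSpace ℝ d → ℝ} (hρ : ContDiff ℝ 1 ρ)
    (hρc : HasCompactSupport ρ) :
    Integrable (fun z => ‖fderiv ℝ ρ z‖ * ‖z‖) volume :=
  ((hρ.continuous_fderiv one_ne_zero).norm.mul continuous_norm).integrable_of_hasCompactSupport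
    (hρc.fderiv (𝕜 := ℝ)).norm.mul_right

/-- **Lipschitz dependence on the matrix**: for a `C¹_c` kernel `ρ`,
`|∫|Dρ(z)(Az)| dz - ∫|Dρ(z)(Bz)| dz| ≤ (∫ ‖Dρ(z)‖ ‖z‖ dz) ‖A - B‖` (used to pass from one
trace-free matrix to a neighbourhood in the compactness step of De Rosa–Inversi 2024,
Prop. 2.8 / §4). [folklore] -/
theorem dist_integral_abs_fderiv_apply_le {ρ : EuclideanSpace ℝ d → ℝ} (hρ : ContDiff ℝ 1 ρ)
    (hρc : HasCompactSupport ρ) (A B : EuclideanSpace ℝ d →L[ℝ] EuclideanSpace ℝ d) :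
    dist (∫ z, |fderiv ℝ ρ z (A z)|) (∫ z, |fderiv ℝ ρ z (B z)|) ≤
      (∫ z, ‖fderiv ℝ ρ z‖ * ‖z‖) * ‖A - B‖ := by
  have hA := integrable_abs_fderiv_apply hρ hρc A
  have hB := integrable_abs_fderiv_apply hρ hρc B
  rw [Real.dist_eq, ← integral_sub hA hB, ← integral_mul_const]
  refine (abs_integral_le_integral_abs).trans ?_
  refine integral_mono (hA.sub hB).abs ((integrable_norm_fderiv_mul_norm hρ hρc).mul_const _)
    fun z => ?_
  simp only
  calc |(|fderiv ℝ ρ z (A z)|) - (|fderiv ℝ ρ z (B z)|)|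
      ≤ |fderiv ℝ ρ z (A z) - fderiv ℝ ρ z (B z)| := abs_abs_sub_abs_le_abs_sub _ _
    _ = |fderiv ℝ ρ z ((A - B) z)| := by rw [← map_sub]; rfl
    _ ≤ ‖fderiv ℝ ρ z‖ * ‖(A - B) z‖ := by
        rw [← Real.norm_eq_abs]; exact ContinuousLinearMap.le_opNorm _ _
    _ ≤ ‖fderiv ℝ ρ z‖ * (‖A - B‖ * ‖z‖) := by
        gcongr; exact ContinuousLinearMap.le_opNorm _ _
    _ = ‖fderiv ℝ ρ z‖ * ‖z‖ * ‖A - B‖ := by ring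

/-- The anisotropic energy is bounded by the moment: `∫|Dρ(z)(Az)| dz ≤ (∫ ‖Dρ(z)‖ ‖z‖ dz) ‖A‖`. [folklore] -/
theorem integral_abs_fderiv_apply_le {ρ : EuclideanSpace ℝ d → ℝ} (hρ : ContDiff ℝ 1 ρ)
    (hρc : HasCompactSupport ρ) (A : EuclideanSpace ℝ d →L[ℝ] EuclideanSpace ℝ d) :
    (∫ z, |fderiv ℝ ρ z (A z)|) ≤ (∫ z, ‖fderiv ℝ ρ z‖ * ‖z‖) * ‖A‖ := by
  have h := dist_integral_abs_fderiv_apply_le hρ hρc A 0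
  have h0 : (∫ z, |fderiv ℝ ρ z ((0 : EuclideanSpace ℝ d →L[ℝ] EuclideanSpace ℝ d) z)|) = 0 := by
    simp
  rw [Real.dist_eq, h0, sub_zero, sub_zero] at h
  exact (le_abs_self _).trans h

end CodimensionOneRigidity

end Literature.Barriers.AnomalousDissipation

end
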